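import Summits.Ventures.PackingBounds.Configurations.OddFamily

/-!
# The `(2n+1)`-point family lives in CUBIC fields

Framing: lottery ticket; floor = certified bounds/negative ranges. Venture `PackingBounds` (cell `pub-packcert`,
seat `pub-packcert-recog`, RECOG.md v35 §26 by-product). `OddFamily.exists_code_card_two_mul_add_one` gives, for
every `n ≥ 2`, a cosine `m ∈ (0, 1/n)` with `Gₙ(m) = 0` for the quartic
`Gₙ(x) = n²(n−2)² x⁴ − 4n(n−1) x³ − 2n² x² + 1` and `2n+1` unit vectors of `ℝⁿ` at pairwise inner product `≤ m`.
The §26 recognition pass returned CUBIC minimal polynomials for every member (`n = 4 … 10`), which exposed the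
factorisation `Gₙ(x) = (n x + 1) · Cₙ(x)` with `Cₙ(x) = n(n−2)² x³ − n² x² − n x + 1` (check: `Gₙ(−1/n) = 0`).
Since `m > 0`, `n m + 1 > 0`, so `Cₙ(m) = 0`: the family's angles are cubic irrationals (`n = 3`: Tammes 7,
`3m³ − 9m² − 3m + 1 = 0`, `m = 0.2101383`, `77.8695°`).
-/

namespace Summit.Ventures.PackingBounds.Config.OddFamily

/-- The cubic factor `Cₙ(m) = n(n−2)² m³ − n² m² − n m + 1` of `Gₙ`. -/
def cubic (n : ℕ) (m : ℝ) : ℝ :=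
  (n : ℝ) * ((n : ℝ) - 2) ^ 2 * m ^ 3 - (n : ℝ) ^ 2 * m ^ 2 - (n : ℝ) * m + 1

/-- `Gₙ(m) = (n m + 1) · Cₙ(m)`. -/
theorem quartic_eq_mul_cubic (n : ℕ) (m : ℝ) : quartic n m = ((n : ℝ) * m + 1) * cubic n m := by
  simp only [quartic, cubic]; ring

/-- **The `(2n+1)`-point family with its CUBIC equation**: for every `n ≥ 2` there is `m ∈ (0, 1/n)` with
`n(n−2)² m³ − n² m² − n m + 1 = 0` and `2n+1` unit vectors of `ℝⁿ` with pairwise inner products `≤ m`. -/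
theorem exists_code_card_two_mul_add_one_cubic (n : ℕ) (hn : 2 ≤ n) :
    ∃ m : ℝ, 0 < m ∧ m < 1 / n ∧ cubic n m = 0 ∧
      ∃ C : Finset (EuclideanSpace ℝ (Fin n)), C.card = 2 * n + 1 ∧ (∀ x ∈ C, ‖x‖ = 1) ∧
        ∀ x ∈ C, ∀ y ∈ C, x ≠ y → inner ℝ x y ≤ m := by
  obtain ⟨m, hm0, hm1, hq, C, hC⟩ := exists_code_card_two_mul_add_one n hn
  refine ⟨m, hm0, hm1, ?_, C, hC⟩
  have hpos : (0 : ℝ) < (n : ℝ) * m + 1 := by positivity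
  rw [quartic_eq_mul_cubic] at hq
  rcases mul_eq_zero.1 hq with h | h
  · exact absurd h hpos.ne'
  · exact h

end Summit.Ventures.PackingBounds.Config.OddFamily
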